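import Summits.MatrixMultiplication.MatrixMultiplication.Theorems.LieRankDesigns.Negative.Walls

/-!
# Negative lemmas for the crux `LevelOneGL2Designs` (stmt-MatrixMultiplication-14080), part W1:
the `2p + 2` linear relations among the level-one Fourier modes on `GL_2(𝔽_p)`

Certified-compute seat (`refuter-ccert-…-14080-0`); no theorem asserts a Theses statement
positively.  Restricted to the GROUP, the `N₁(p) = p³ + p² − p` functions `g ↦ ψ(tr(M g))`
(`rk M ≤ 1`) satisfy, for every nonzero `u` resp. `ξ`, the COLUMN relation
`Σ_ξ ψ(tr(u ξᵀ g)) = Σ_ξ ψ(ξ·(g u)) = p²·[g u = 0] = 0` and the ROW relation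
`Σ_u ψ(tr(u ξᵀ g)) = p²·[gᵀ ξ = 0] = 0`.  This file: the orthogonality relation on `𝔽_p²`
(`sum_psi_dotProduct`), outer products and normalised representatives `(x,1)`, `(1,0)` of `P¹`,
the relation tables `colRel`, `rowRel` as tables over `{M : rk M ≤ 1}`, their vanishing under
`levelMap` (`levelMap_colRel`, `levelMap_rowRel`), and their values at outer products of
representatives (used for linear independence in part W2, `SharpWall.lean`).
-/

set_option linter.dupNamespace false

noncomputable section

open scoped BigOperators

namespace Summit.MatrixMultiplication.MatrixMultiplication.Theorems.LevelOneGL2Designs.Negative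

open Summit.MatrixMultiplication.MatrixMultiplication.Theorems.LieRankDesigns.Negative

variable {p : ℕ} [Fact p.Prime]

/-! ## Orthogonality on `𝔽_p²` -/

/-- `Σ_{ξ ∈ 𝔽_p²} ψ(ξ·v) = p²·[v = 0]`. [folklore] -/
theorem sum_psi_dotProduct (v : Fin 2 → ZMod p) :
    ∑ ξ : Fin 2 → ZMod p, (ZMod.stdAddChar (ξ ⬝ᵥ v) : ℂ) = if v = 0 then ((p : ℂ) ^ 2) else 0 := by
  classical
  have hexp : ∀ ξ : Fin 2 → ZMod p, (ZMod.stdAddChar (ξ ⬝ᵥ v) : ℂ) =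
      ∏ i : Fin 2, (ZMod.stdAddChar (ξ i * v i) : ℂ) := by
    intro ξ
    rw [dotProduct, Fin.sum_univ_two, Fin.prod_univ_two, AddChar.map_add_eq_mul]
  simp_rw [hexp]
  rw [← Fintype.prod_sum fun (i : Fin 2) (x : ZMod p) => (ZMod.stdAddChar (x * v i) : ℂ)]
  have hin : ∀ a : ZMod p, (∑ x : ZMod p, (ZMod.stdAddChar (x * a) : ℂ)) =
      if a = 0 then (p : ℂ) else 0 := by
    intro a
    rw [AddChar.sum_mulShift a (ZMod.isPrimitive_stdAddChar p), ZMod.card]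
    split_ifs <;> simp
  simp_rw [hin]
  rw [Fin.prod_univ_two]
  by_cases h0 : v 0 = 0
  · by_cases h1 : v 1 = 0
    · have hv : v = 0 := by
        funext i; fin_cases i
        · exact h0
        · exact h1
      rw [if_pos h0, if_pos h1, if_pos hv]; ring
    · have hv : v ≠ 0 := fun h => h1 (by rw [h]; rfl)
      rw [if_pos h0, if_neg h1, if_neg hv, mul_zero]
  · have hv : v ≠ 0 := fun h => h0 (by rw [h]; rfl)
    rw [if_neg h0, if_neg hv, zero_mul]

/-! ## Outer products `u ξᵀ` -/

/-- An outer product has rank `≤ 1`, as an element of the level-one support. -/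
def outer (u ξ : Fin 2 → ZMod p) : {M : Mat p 2 // M.rank ≤ 1} :=
  ⟨Matrix.vecMulVec u ξ, Matrix.rank_vecMulVec_le u ξ⟩

/-- `tr(u ξᵀ g) = ξ · (g u)`. [folklore] -/
theorem trace_outer_mul (u ξ : Fin 2 → ZMod p) (g : Mat p 2) :
    Matrix.trace (Matrix.vecMulVec u ξ * g) = ξ ⬝ᵥ (g.mulVec u) := by
  rw [Matrix.trace_fin_two]
  simp only [Matrix.mul_apply, Fin.sum_univ_two, Matrix.vecMulVec_apply, dotProduct,
    Matrix.mulVec]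
  ring

/-- `u ξᵀ = u' ξ'ᵀ` with `u ≠ 0`, `ξ ≠ 0` forces `u' ∥ u`: `u = c • u'` for some `c`. -/
theorem exists_smul_of_vecMulVec_eq {u ξ u' ξ' : Fin 2 → ZMod p} (hξ : ξ ≠ 0)
    (h : Matrix.vecMulVec u ξ = Matrix.vecMulVec u' ξ') : ∃ c : ZMod p, u = c • u' := by
  obtain ⟨j, hj⟩ : ∃ j, ξ j ≠ 0 := by
    by_contra hall; push Not at hall; exact hξ (funext hall)
  have hcol : ∀ i, u i * ξ j = u' i * ξ' j := fun i => by
    have := congrFun (congrFun h i) j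
    simpa [Matrix.vecMulVec_apply] using this
  refine ⟨ξ' j / ξ j, funext fun i => ?_⟩
  rw [Pi.smul_apply, smul_eq_mul]
  field_simp
  linear_combination hcol i

/-- Dually `ξ ∥ ξ'`. -/
theorem exists_smul_of_vecMulVec_eq' {u ξ u' ξ' : Fin 2 → ZMod p} (hu : u ≠ 0)
    (h : Matrix.vecMulVec u ξ = Matrix.vecMulVec u' ξ') : ∃ c : ZMod p, ξ = c • ξ' := by
  have ht : Matrix.vecMulVec ξ u = Matrix.vecMulVec ξ' u' := by
    rw [← Matrix.transpose_vecMulVec u ξ, h, Matrix.transpose_vecMulVec]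
  exact exists_smul_of_vecMulVec_eq hu ht

/-! ## Normalised representatives of `P¹(𝔽_p)`: `(x, 1)` and `(1, 0)` -/

/-- Column representatives, indexed by `Option (ZMod p)`: `some x ↦ (x,1)`, `none ↦ (1,0)`. -/
def repU : Option (ZMod p) → (Fin 2 → ZMod p)
  | some x => ![x, 1]
  | none => ![1, 0]

/-- Row representatives, indexed by `ZMod p`: `x ↦ (x, 1)`. -/
def repE (x : ZMod p) : Fin 2 → ZMod p := ![x, 1]

/-- `(1,0) ≠ 0`. -/
theorem e1_ne_zero : (![1, 0] : Fin 2 → ZMod p) ≠ 0 := by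
  intro h; have := congrFun h 0; simp at this

/-- Row representatives are nonzero. -/
theorem repE_ne_zero (x : ZMod p) : repE x ≠ 0 := by
  intro h; have := congrFun h 1; simp [repE] at this

/-- Column representatives are nonzero. -/
theorem repU_ne_zero (i : Option (ZMod p)) : repU i ≠ 0 := by
  cases i with
  | none => exact e1_ne_zero
  | some x => exact repE_ne_zero x

/-- `(x,1)` is not parallel to a different `(y,1)`. -/
theorem repE_eq_of_smul {x y : ZMod p} {c : ZMod p} (h : repE x = c • repE y) : x = y := by
  have h1 := congrFun h 1
  simp [repE] at h1
  have h0 := congrFun h 0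
  simp [repE, ← h1] at h0
  exact h0

/-- `(1,0)` is not parallel to `(y,1)`. -/
theorem e1_ne_smul_repE (y c : ZMod p) : (![1, 0] : Fin 2 → ZMod p) ≠ c • repE y := by
  intro h
  have h1 := congrFun h 1
  simp [repE] at h1
  have h0 := congrFun h 0
  simp [repE, ← h1] at h0

/-- `(y,1)` is not parallel to `(1,0)`. -/
theorem repE_ne_smul_e1 (y c : ZMod p) : repE y ≠ c • (![1, 0] : Fin 2 → ZMod p) := by
  intro h
  have h1 := congrFun h 1
  simp [repE] at h1

/-- Parallel column representatives are equal. -/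
theorem repU_eq_of_smul {i j : Option (ZMod p)} {c : ZMod p} (h : repU i = c • repU j) : i = j := by
  cases i with
  | none =>
    cases j with
    | none => rfl
    | some y => exact absurd h (e1_ne_smul_repE y c)
  | some x =>
    cases j with
    | none => exact absurd h (repE_ne_smul_e1 x c)
    | some y => exact congrArg some (repE_eq_of_smul h)

/-! ## The relation tables and their image under `levelMap` -/

/-- Column relation table of `u`: the indicator of `{u ξᵀ : ξ ∈ 𝔽_p²}`. -/
def colRel (u : Fin 2 → ZMod p) : {M : Mat p 2 // M.rank ≤ 1} → ℂ :=
  fun M => if ∃ ξ : Fin 2 → ZMod p, M = outer u ξ then 1 else 0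

/-- Row relation table of `ξ`: the indicator of `{u ξᵀ : u ∈ 𝔽_p²}`. -/
def rowRel (ξ : Fin 2 → ZMod p) : {M : Mat p 2 // M.rank ≤ 1} → ℂ :=
  fun M => if ∃ u : Fin 2 → ZMod p, M = outer u ξ then 1 else 0

/-- `levelMap` of a table, pointwise. -/
theorem levelMap_apply (c : {M : Mat p 2 // M.rank ≤ 1} → ℂ) (g : GLm p 2) :
    levelMap p 2 1 c g = ∑ M : {M : Mat p 2 // M.rank ≤ 1},
      c M * ZMod.stdAddChar (Matrix.trace (M.1 * (g : Mat p 2))) := rfl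

/-- `ξ ↦ u ξᵀ` is injective for `u ≠ 0`. -/
theorem outer_injective_right {u : Fin 2 → ZMod p} (hu : u ≠ 0) :
    Function.Injective (fun ξ : Fin 2 → ZMod p => outer u ξ) := by
  intro ξ ξ' h
  have h' : Matrix.vecMulVec u ξ = Matrix.vecMulVec u ξ' := congrArg Subtype.val h
  obtain ⟨i, hi⟩ : ∃ i, u i ≠ 0 := by
    by_contra hall; push Not at hall; exact hu (funext hall)
  funext j
  have := congrFun (congrFun h' i) j
  simp only [Matrix.vecMulVec_apply] at this
  exact mul_left_cancel₀ hi this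

/-- `u ↦ u ξᵀ` is injective for `ξ ≠ 0`. -/
theorem outer_injective_left {ξ : Fin 2 → ZMod p} (hξ : ξ ≠ 0) :
    Function.Injective (fun u : Fin 2 → ZMod p => outer u ξ) := by
  intro u u' h
  have h' : Matrix.vecMulVec u ξ = Matrix.vecMulVec u' ξ := congrArg Subtype.val h
  obtain ⟨j, hj⟩ : ∃ j, ξ j ≠ 0 := by
    by_contra hall; push Not at hall; exact hξ (funext hall)
  funext i
  have := congrFun (congrFun h' i) j
  simp only [Matrix.vecMulVec_apply] at this
  exact mul_right_cancel₀ hj this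

omit [Fact p.Prime] in
/-- A sum of an indicator-weighted function over the image of an injective map. -/
theorem sum_indicator_image {α β : Type} [Fintype α] [Fintype β] [DecidableEq β]
    (e : α → β) (he : Function.Injective e) (F : β → ℂ) :
    ∑ b : β, (if ∃ a, b = e a then 1 else 0) * F b = ∑ a : α, F (e a) := by
  classical
  have hfilter : (Finset.univ.filter fun b : β => ∃ a, b = e a) = Finset.univ.map ⟨e, he⟩ := by
    ext b
    simp only [Finset.mem_filter, Finset.mem_univ, true_and, Finset.mem_map,
      Function.Embedding.coeFn_mk]
    constructor
    · rintro ⟨a, rfl⟩; exact ⟨a, rfl⟩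
    · rintro ⟨a, rfl⟩; exact ⟨a, rfl⟩
  rw [← Finset.sum_filter_add_sum_filter_not Finset.univ (fun b : β => ∃ a, b = e a)]
  have h2 : ∑ b ∈ Finset.univ.filter (fun b : β => ¬ ∃ a, b = e a),
      (if ∃ a, b = e a then 1 else 0) * F b = 0 :=
    Finset.sum_eq_zero fun b hb => by rw [if_neg (Finset.mem_filter.mp hb).2, zero_mul]
  rw [h2, add_zero, hfilter, Finset.sum_map]
  refine Finset.sum_congr rfl fun a _ => ?_
  simp only [Function.Embedding.coeFn_mk]
  rw [if_pos ⟨a, rfl⟩, one_mul]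

/-- **Column relations**: `levelMap (colRel u) = 0` for `u ≠ 0` — on the group,
`Σ_ξ ψ(tr(u ξᵀ g)) = Σ_ξ ψ(ξ·(g u)) = p²·[g u = 0] = 0`. -/
theorem levelMap_colRel {u : Fin 2 → ZMod p} (hu : u ≠ 0) : levelMap p 2 1 (colRel u) = 0 := by
  classical
  funext g
  rw [levelMap_apply, Pi.zero_apply]
  rw [show (∑ M : {M : Mat p 2 // M.rank ≤ 1},
      colRel u M * (ZMod.stdAddChar (Matrix.trace (M.1 * (g : Mat p 2))) : ℂ)) =
      ∑ ξ : Fin 2 → ZMod p, (ZMod.stdAddChar (Matrix.trace ((outer u ξ).1 * (g : Mat p 2))) : ℂ)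
    from sum_indicator_image (outer u) (outer_injective_right hu) _]
  simp only [outer, trace_outer_mul]
  rw [sum_psi_dotProduct, if_neg]
  intro h0
  apply hu
  have hunit : IsUnit (g : Mat p 2) := Units.isUnit g
  exact (Matrix.mulVec_injective_iff_isUnit.mpr hunit) (by rw [h0, Matrix.mulVec_zero])

/-- **Row relations**: `levelMap (rowRel ξ) = 0` for `ξ ≠ 0`. -/
theorem levelMap_rowRel {ξ : Fin 2 → ZMod p} (hξ : ξ ≠ 0) : levelMap p 2 1 (rowRel ξ) = 0 := by
  classical
  funext g
  rw [levelMap_apply, Pi.zero_apply]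
  rw [show (∑ M : {M : Mat p 2 // M.rank ≤ 1},
      rowRel ξ M * (ZMod.stdAddChar (Matrix.trace (M.1 * (g : Mat p 2))) : ℂ)) =
      ∑ u : Fin 2 → ZMod p, (ZMod.stdAddChar (Matrix.trace ((outer u ξ).1 * (g : Mat p 2))) : ℂ)
    from sum_indicator_image (fun u => outer u ξ) (outer_injective_left hξ) _]
  simp only [outer, trace_outer_mul]
  have hsw : ∀ u : Fin 2 → ZMod p,
      ξ ⬝ᵥ ((g : Mat p 2).mulVec u) = u ⬝ᵥ ((g : Mat p 2).transpose.mulVec ξ) := by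
    intro u
    rw [Matrix.dotProduct_mulVec, dotProduct_comm, ← Matrix.mulVec_transpose]
  simp_rw [hsw]
  rw [sum_psi_dotProduct, if_neg]
  intro h0
  apply hξ
  have hdet : IsUnit ((g : Mat p 2).transpose) := by
    rw [Matrix.isUnit_iff_isUnit_det, Matrix.det_transpose]
    exact (Matrix.isUnit_iff_isUnit_det _).mp (Units.isUnit g)
  exact (Matrix.mulVec_injective_iff_isUnit.mpr hdet) (by rw [h0, Matrix.mulVec_zero])

/-! ## Evaluations of the relation tables at outer products of representatives -/

/-- A column table at an outer product of representatives: `colRel uᵢ (uⱼ ξᵀ) = [i = j]`. -/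
theorem colRel_repU_apply_outer (i j : Option (ZMod p)) {ξ : Fin 2 → ZMod p} (hξ : ξ ≠ 0) :
    colRel (repU i) (outer (repU j) ξ) = if i = j then 1 else 0 := by
  unfold colRel
  by_cases h : i = j
  · subst h; rw [if_pos ⟨ξ, rfl⟩, if_pos rfl]
  · rw [if_neg h, if_neg]
    rintro ⟨ξ', hξ'⟩
    have hv : Matrix.vecMulVec (repU j) ξ = Matrix.vecMulVec (repU i) ξ' := congrArg Subtype.val hξ'
    obtain ⟨c, hc⟩ := exists_smul_of_vecMulVec_eq hξ hv
    exact h (repU_eq_of_smul hc).symm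

/-- A row table at an outer product of representatives: `rowRel ξₓ (u ξ_yᵀ) = [x = y]`. -/
theorem rowRel_repE_apply_outer (x y : ZMod p) {u : Fin 2 → ZMod p} (hu : u ≠ 0) :
    rowRel (repE x) (outer u (repE y)) = if x = y then 1 else 0 := by
  unfold rowRel
  by_cases h : x = y
  · subst h; rw [if_pos ⟨u, rfl⟩, if_pos rfl]
  · rw [if_neg h, if_neg]
    rintro ⟨u', hu'⟩
    have hv : Matrix.vecMulVec u (repE y) = Matrix.vecMulVec u' (repE x) := congrArg Subtype.val hu'
    obtain ⟨c, hc⟩ := exists_smul_of_vecMulVec_eq' hu hv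
    exact h (repE_eq_of_smul hc).symm

/-- A row table of `(x,1)` vanishes at `u e₁ᵀ`. -/
theorem rowRel_repE_apply_outer_e1 (x : ZMod p) {u : Fin 2 → ZMod p} (hu : u ≠ 0) :
    rowRel (repE x) (outer u ![1, 0]) = 0 := by
  unfold rowRel
  rw [if_neg]
  rintro ⟨u', hu'⟩
  have hv : Matrix.vecMulVec u ![1, 0] = Matrix.vecMulVec u' (repE x) := congrArg Subtype.val hu'
  obtain ⟨c, hc⟩ := exists_smul_of_vecMulVec_eq' hu hv
  exact e1_ne_smul_repE x c hc


end Summit.MatrixMultiplication.MatrixMultiplication.Theorems.LevelOneGL2Designs.Negative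

end
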